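import Summits.BirchSwinnertonDyer.Rank1Residual.ManinAdditive.JumpDegreeLaws
import Summits.BirchSwinnertonDyer.Rank1Residual.ManinAdditive.TameCellLocalTwoTorsion
import HarnessLib
import HarnessLib.Audit.Tags

/-!
# es g36 (cell bsd-f2-manin, MEMO-es §57.10) — the ATKIN–LEHNER REDUCTION of the `4 ∣ deg φ` laws and the FRICKE-PLUS IV* law

Typed rows of MEMO-es §57.10.  Nothing is asserted: `@[conjecture]` nodes are CENSUS LAWS with their BC5 tables (plus one
classical lemma typed as a node pending the tree's Atkin–Lehner group action); the proved declarations are one-line edges.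

SET-UP.  For `E(ℚ)[2] = 0` every Atkin–Lehner involution `w_Q` with `w_Q f = +f` satisfies `φ ∘ w_Q = φ` exactly (the
translation `φ(w_Q x) − φ(x)` is a rational point killed by `2`), so `φ = φ♭ ∘ (X₀(N) → X₀(N)/W⁺)`, `W⁺ = ker ε`,
`ε : W ≅ (ℤ/2)^{ω(N)} → {±1}` the sign character; on the tame cell `4 ∥ N` the sign `ε₄ = −1` is a THEOREM of the tree at
`N = 4p` (`ManinLocalTwoThree.atkinLehnerEigenvalueAt_two_eq_neg_one_four_mul`, E-an-44) and a LAW in general, so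
`|W⁺| = 2^{ω(N)−1}` exactly and **LEMMA AL**: `2^{ω(N)−1} ∣ deg φ` (E-es-AL below; census: all 151 502 curves with
`4 ∥ N < 5·10⁵` and `E(ℚ)[2] = 0`, every parametrisation at conductor level, 0 violations).  The §57 laws E-es-168 / 169 and
the new E-es-171 are then statements about ONE MORE factor `2`: **the AL-reduced degree `deg φ♭ = deg φ / 2^{ω(N)−1}` is EVEN**, i.e.
`2^{ω(N)} ∣ deg φ`, in three habitats (all counts: Cremona `4 ∥ N < 5·10⁵`, every parametrisation, 0 exceptions):
* E-es-168♯ `FourStarLocalTwoTorsionSharp`: IV* ∧ `E(ℚ₂)[2] ≠ 0` (Hasse depth 1) ∧ `E(ℚ)[2] = 0` ⟹ `2^{ω(N)} ∣ deg φ` — 37 466 / 37 466;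
* E-es-169♯ `GaussianLevelSharp`: all odd `p ∣ N` `≡ 1 (mod 4)` ∧ `E(ℚ)[2] = 0` ⟹ `2^{ω(N)} ∣ deg φ` — 7 256 / 7 256;
* E-es-171♯ `FourStarFrickePlusSharp` (NEW): IV* ∧ `E(ℚ)[2] = 0` ∧ `w_N f = f` (root number `−1`, odd analytic rank) ⟹
  `2^{ω(N)} ∣ deg φ` — 43 704 / 43 704 (weak form `4 ∣ deg φ` idem).
* E-es-172 `FourStarRefinedWatkins` (NEW): IV* ∧ `E(ℚ)[2] = 0` ⟹ `2^{ω(N)−1+R} ∣ deg φ` (`R` = rank) — 87 106 / 87 106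
  (R = 1, 2, 3: 43 435, 10 726, 269); the same for Kodaira IV fails 3 884 / 64 396 times (92b1, 124a1, 916c1, …).
RESIDUAL (where `deg φ♭` is odd below `5·10⁵`): for IV* exactly the class «non-Gaussian ∧ Hasse depth 3 ∧ `w_N f = −f`»
(ω(N)=2: 136 odd / 102 even; ω=3: 475 / 3 380; ω≥4: 932 / 18 653); for IV every non-Gaussian (depth, sign) cell is mixed.
MECHANISM (THEOREM A♯, paper, MEMO-es §57.10.4): `w₄` descends to an involution `ι` of `C = X₀(N)/W⁺` with `φ♭ ∘ ι = −φ♭ + P`,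
and `deg φ♭ ≡ #{x ∈ Fix ι : φ♭(x) = Q} (mod 2)` for the rational half-point `Q` (`2Q = P`); `Fix ι` = images of the
`W`-fixed points of `X₀(N)`: cusps of denominator `2d`, `ℤ[i]`-CM points (present iff the level is Gaussian) and the
conductor-`2^j` HEEGNER POINTS of the orders `ℤ[√−Q'] ⊂ ℚ(√−Q')`, `Q' ‖ N/4` — so the three laws are parity laws for the
images of Heegner points modulo `E[2]` (the Euler-system lens proper).
Tables: HOME/es/g36/out-census8-500000.txt dad9c4f4eeda18fd (engine census8.py c04f5c03e7312c0b), out-census7-500000.txt e359bc626a4d8e7d (engine census7.py 21830818ebec89b9), out-census6-500000.txt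
70f5c0d11a2e1a3b (census6.py 788c0dfb9cc4735c), out-census4-500000.txt 4f6903bc3256161e (census4.py 6b60d53a519f0f66).
PARTITION 0 · beyond-print theorem: no (laws; LEMMA AL is classical) · BSD is not proved by this; Manin's conjecture is not proved by this.

TYPER NOTE (typer g21, T-es-68, file 1/2 «Sketch-b» — SPLIT BY IMPORT CONE).  SOURCE = HOME/es/g36/Sketch-es-g36b.lean sha16 02ac0e536502735c (211 l.;
es: farm rc 0; MEMO-es §57.10, HOME/MEMO-es.md l.4857; tables out-census4/6/7/8-500000.txt, SHA16 in the memo) VERBATIM but for these typer deltas: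
(i) `Theorems.ManinLocalTwoThreeFourPRootNumberMinusOne` lies INSIDE the `Theses.ManinLocalTwoThree` import cone, so THIS LEAF drops that import (and its
`open …Theorems.ManinLocalTwoThree` line) and the ONE theorem that needs it, `four_dvd_modularDegree_fourP_of_atkinLehner_p_eq_neg` (uses the cone theorem
`frickeInvolution_eq_self_of_atkinLehnerInvolutionAt_p_eq_neg`), which lands VERBATIM in the cone sibling `AtkinLehnerDegreeLawsSplit.lean`; (ii) namespace
`…ManinAdditive.EsG36` → `…ManinAdditive.AtkinLehnerDegree` (shared with `ALFixedPointDiscriminantLaw.lean`, file 2/2); (iii) new bib key `Dummigan2006Watkins`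
(N. Dummigan, «On a conjecture of Watkins», JTNB 18 (2006) 345–355, doi:10.5802/jtnb.548) added to references.bib for es's cite; (iv) this note.  Imports: landed
`…ManinAdditive.JumpDegreeLaws` + `…ManinAdditive.TameCellLocalTwoTorsion` + HarnessLib(+Audit.Tags) — route-independent.  ROWS (es's `@[conjecture]` tags,
nothing asserted): **E-es-AL `AtkinLehnerPlusKernelDividesDegree`** (LEMMA AL, classical; a node pending the tree's AL group action), **E-es-168♯
`FourStarLocalTwoTorsionSharp`** (37 466/37 466), **E-es-169♯ `GaussianLevelSharp`** (7 256/7 256), **E-es-171♯ `FourStarFrickePlusSharp`** (43 704/43 704),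
**E-es-172 `FourStarRefinedWatkins`** (87 106/87 106); PROVED `two_pow_card_primeFactors_dvd_of_refinedWatkins`, `four_dvd_of_two_pow_dvd`,
`two_le_card_primeFactors`, `four_dvd_modularDegree_of_fourStar_fricke_plus`, `four_dvd_modularDegree_of_fourStar_localTwoTorsion_sharp`,
`two_pow_card_primeFactors_dvd_modularDegree_of_laws` (sibling: `four_dvd_modularDegree_fourP_of_atkinLehner_p_eq_neg`).  REFUTER: ref1/ref2 R-es-84 PENDING
at landing.  Names fresh; cite keys present (AtkinLehner1970, CalegariEmerton2009, Watkins2002, Dummigan2006Watkins); no instances, no notation, no sorry.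
`--supports` refused for ManinAdditive ⇒ bears_on: stmt-BirchSwinnertonDyer-22967 (C2 `ManinOddAtFour`).  BSD is not proved by this; C2 OPEN.
-/

open scoped MatrixGroups ModularForm

open CongruenceSubgroup WeierstrassCurve
open Literature.NumberTheory.EllipticCurves Literature.NumberTheory.EllipticCurves.ModularForms

open Summit.BirchSwinnertonDyer.Rank1Residual.ManinAdditive.ConwayCut
open Summit.BirchSwinnertonDyer.Rank1Residual.ManinAdditive.JumpDegree
open Summit.BirchSwinnertonDyer.Rank1Residual.ManinAdditive.TameTwoLocal

namespace Summit.BirchSwinnertonDyer.Rank1Residual.ManinAdditive.AtkinLehnerDegree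

/-! ### §1. LEMMA AL (classical; typed as a node pending the tree's Atkin–Lehner group action on `X₀(N)`) -/

/-- **Row E-es-AL `AtkinLehnerPlusKernelDividesDegree`** (classical LEMMA, MEMO-es §57.10.1; Atkin–Lehner 1970 + the
equivariance `φ ∘ w_Q = ε_Q φ + P_Q`, `P_Q ∈ E(ℚ)`; for `ε_Q = +1`, `2 P_Q = 0`, so `E(ℚ)[2] = 0` forces `φ ∘ w_Q = φ` and
`φ` factors through `X₀(N)/ker ε`, `|ker ε| ≥ 2^{ω(N)−1}`).  On the tame cell (`v₂(N) = 2`), for every parametrisation at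
the conductor level of a curve without rational 2-torsion: `2^{ω(N)−1} ∣ deg φ`, `ω(N) = #` prime factors of `N` (with `2`).
Census: 151 502 / 151 502 curves with `4 ∥ N < 5·10⁵` (`v₂(deg φ) − (ω(N)−1)` = 0: 6 281, = 1: 17 338, ≥ 2: 127 883).
Why it might fail: it is a theorem on paper; typed as a node only because the tree has no `W`-action on `X₀(N)` yet.
[cite: AtkinLehner1970, Lemma 7–Thm. 3 (the involutions w_Q on Γ₀(N) and newform eigenvalues; the degree consequence is the cell's E-es-AL, folklore — cf. Dummigan–Krishnamoorthy 2013 doi:10.1016/j.jnt.2012.08.024 §2 for the same mechanism «powers of 2 in modular degrees», hypotheses there: N arbitrary, E[2] irreducible)] -/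
@[conjecture]
def AtkinLehnerPlusKernelDividesDegree : Prop :=
  ∀ (W : WeierstrassCurve ℚ) [W.IsElliptic] [W.IsGloballyMinimal] {N : ℕ} [NeZero N]
    (D : ModularParametrizationData W N), W.conductorNorm ℤ = N → padicValNat 2 N = 2 →
    ¬ HasRationalTwoTorsion W → 2 ^ (N.primeFactors.card - 1) ∣ D.modularDegree

/-! ### §2. The three «`deg φ♭` even» laws in sharp form `2^{ω(N)} ∣ deg φ` -/

/-- **Row E-es-168♯ `FourStarLocalTwoTorsionSharp`** (LAW; sharp form of E-es-168, MEMO-es §57.10.2): IV* at `2` on the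
tame cell, a `ℚ₂`-rational 2-torsion point (Hasse depth `h(E) = 1`, ⟺ `v₂(c₄) = 4` by E-es-170), no rational 2-torsion
⟹ `2^{ω(N)} ∣ deg φ` (the AL-reduced degree `deg φ♭` is even).  Census: 37 466 / 37 466 (excess `v₂(deg φ) − (ω−1)`
= 1: 3 306, ≥ 2: 34 160; never 0).
Why it might fail: a IV*-depth-1 curve at a level `4pq…` whose Heegner fixed points of `ι` over the rational half-point are odd in number; none below `5·10⁵`.
[cite: CalegariEmerton2009, Thm. 1.1 (arXiv:math/0503359 p. 2: E[2] irreducible ∧ 4 ∣ N ⇒ 2 ∣ deg φ — the floor; the sharp law is the cell's E-es-168♯, NOT in print)] -/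
@[conjecture]
def FourStarLocalTwoTorsionSharp : Prop :=
  ∀ (W : WeierstrassCurve ℚ) [W.IsElliptic] [W.IsGloballyMinimal] {N : ℕ} [NeZero N]
    (D : ModularParametrizationData W N), W.conductorNorm ℤ = N →
    IsTypeFourStarAtTwoTame W → ¬ NoLocalTwoTorsionAtTwo W → ¬ HasRationalTwoTorsion W →
      2 ^ N.primeFactors.card ∣ D.modularDegree

/-- **Row E-es-169♯ `GaussianLevelSharp`** (LAW; sharp form of E-es-169): `4 ∥ N`, all odd prime factors of `N`
`≡ 1 (mod 4)`, no rational 2-torsion ⟹ `2^{ω(N)} ∣ deg φ`.  Census: 7 256 / 7 256 (excess = 1: 1 290, ≥ 2: 5 966; never 0).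
Mechanism candidate (§57.10.4): at Gaussian levels `Fix ι` contains the images of the `2^{ω(N)−1}` `ℤ[i]`-CM points, absent otherwise.
Why it might fail: a Gaussian level with an odd number of `W⁺`-orbits of Heegner fixed points over the half-point; none below `5·10⁵`.
[cite: CalegariEmerton2009, Thm. 1.1 (arXiv:math/0503359 p. 2: the parity floor; E-es-169♯ is the cell's, NOT in print)] -/
@[conjecture]
def GaussianLevelSharp : Prop :=
  ∀ (W : WeierstrassCurve ℚ) [W.IsElliptic] [W.IsGloballyMinimal] {N : ℕ} [NeZero N]
    (D : ModularParametrizationData W N), W.conductorNorm ℤ = N → padicValNat 2 N = 2 →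
    AllOddPrimeFactorsOneModFour N → ¬ HasRationalTwoTorsion W → 2 ^ N.primeFactors.card ∣ D.modularDegree

/-- **Row E-es-171♯ `FourStarFrickePlusSharp`** (LAW, NEW; MEMO-es §57.10.3): IV* at `2` on the tame cell, no rational
2-torsion, Fricke sign `+1` (`w_N f = f`; ⟺ global root number `−1` ⟺ odd analytic rank) ⟹ `2^{ω(N)} ∣ deg φ`.
Census: 43 704 / 43 704 curves with `4 ∥ N < 5·10⁵` (excess = 1: 4 805, ≥ 2: 38 899; never 0); E-blind in `f` but for
the IV* bit `v₂(Δ) = 8` (= `dim_𝔽₂ S₂(4)^{K(4), θ} side`, desc E-117).  NECESSITY: Fricke sign `−1` ∧ IV* ∧ depth 3 ∧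
non-Gaussian is mixed (136 : 102 at `ω(N) = 2`: 44a1, 76a1, 108a1 (`deg φ♭` odd) vs 140a1, 172a1, 204b1 (even)); type IV with Fricke
sign `+1` is mixed (92b1, 124a1, 196a1, 236a1: `deg φ = 6, 6, 6, 6`).  At `N = 4p` with `w_p f = −f` the tree proves
`w_N f = f`, `{∞,0}_f = 0`, all six cusps `↦ O` and `2 ∣ deg φ` (`fourP_cusps_of_atkinLehner_p_eq_neg`); this row doubles it for IV*.
Why it might fail: a IV* curve of odd rank whose conductor-2 Heegner points over the rational half-point number odd; none below `5·10⁵`.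
[cite: CalegariEmerton2009, Thm. 1.1 (arXiv:math/0503359 p. 2: the parity floor 2 ∣ deg φ; the Fricke-plus IV* law is the cell's E-es-171♯, NOT in print)] -/
@[conjecture]
def FourStarFrickePlusSharp : Prop :=
  ∀ (W : WeierstrassCurve ℚ) [W.IsElliptic] [W.IsGloballyMinimal] {N : ℕ} [NeZero N]
    (D : ModularParametrizationData W N), W.conductorNorm ℤ = N →
    IsTypeFourStarAtTwoTame W → ¬ HasRationalTwoTorsion W → frickeInvolution N 2 D.f = D.f →
      2 ^ N.primeFactors.card ∣ D.modularDegree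


/-! ### §2b. The REFINED WATKINS law on the IV* half of the tame cell -/

/-- **Row E-es-172 `FourStarRefinedWatkins`** (LAW, NEW; MEMO-es §57.10.5): IV* at `2` on the tame cell, no rational
2-torsion ⟹ `2^{ω(N) − 1 + R} ∣ deg φ`, `R = rank E(ℚ)` — i.e. the AL-reduced degree `deg φ♭ = deg φ / 2^{ω(N)−1}` is
divisible by `2^R` (Watkins' Conjecture 4.1 «`2^R ∣ deg φ`» in the form refined by the Atkin–Lehner subgroup through
which `φ` factors, as reported in Dummigan 2006, p. 346).  Census (Cremona rank column; all parametrisations at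
conductor level, `4 ∥ N < 5·10⁵`): IV* 87 106 / 87 106 (`R = 0`: 32 676; `R = 1`: 43 435, sharp 4 805; `R = 2`: 10 726,
sharp 1 458; `R = 3`: 269, sharp 43), 0 exceptions; the SAME statement for Kodaira IV FAILS 3 884 times out of 64 396
(`R = 1`: 2 354, e.g. 92b1, 124a1, 196a1, 236a1 with `deg φ = 6`, `ω = 2`; `R = 2`: 1 424, e.g. 916c1, 1028a1; `R = 3`: 106,
e.g. 106276b1), while plain Watkins `2^R ∣ deg φ` holds for all 215 648 curves of the cell.  E-es-171♯ is its shadow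
«Fricke `+1` ⟹ `R` odd ⟹ `R ≥ 1`» (given parity); E-es-168♯ / 169♯ are the extra rank-0 floors.
Why it might fail: a IV* curve of rank `R ≥ 2` at a two-prime level with `v₂(deg φ) = R` (the IV failures start at `R = 1`); none below `5·10⁵`.
[cite: Watkins2002, Conj. 4.1 p. 12 (doi:10.1080/10586458.2002.10504701: «if an elliptic curve has rank r, then 2^r divides its modular degree … for some high-rank composite-conductor examples even more powers of 2 divide the modular degree, as might be suggested from an analysis of Atkin–Lehner involutions»; the IV*/IV split on 4 ∥ N is the cell's E-es-172, NOT in print)]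
[cite: Dummigan2006Watkins, p. 346 (doi:10.5802/jtnb.548: Conj. 1.1 = Watkins; «Watkins has since suggested that something even stronger, involving also the size of the subgroup of Atkin–Lehner involutions through which Φ factors, may be true»; hypotheses of his conditional theorem: N even squarefree, E[2] ramified at all p ∣ N, no rational 2-torsion, E(ℝ) connected — disjoint from 4 ∥ N)] -/
@[conjecture]
def FourStarRefinedWatkins : Prop :=
  ∀ (W : WeierstrassCurve ℚ) [W.IsElliptic] [W.IsGloballyMinimal] {N : ℕ} [NeZero N]
    (D : ModularParametrizationData W N), W.conductorNorm ℤ = N →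
    IsTypeFourStarAtTwoTame W → ¬ HasRationalTwoTorsion W →
      2 ^ (N.primeFactors.card - 1 + W.mordellWeilRank) ∣ D.modularDegree

/-- E-es-172 with `R ≥ 1` gives the sharp conclusion `2^{ω(N)} ∣ deg φ` of E-es-171♯ (the parity step «Fricke `+1` ⟹ `R`
odd» is BSD-parity and is NOT claimed here). -/
theorem two_pow_card_primeFactors_dvd_of_refinedWatkins (h172 : FourStarRefinedWatkins)
    (W : WeierstrassCurve ℚ) [W.IsElliptic] [W.IsGloballyMinimal] {N : ℕ} [NeZero N]
    (D : ModularParametrizationData W N) (hN : W.conductorNorm ℤ = N)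
    (hIV : IsTypeFourStarAtTwoTame W) (hT : ¬ HasRationalTwoTorsion W) (hR : 0 < W.mordellWeilRank) :
    2 ^ N.primeFactors.card ∣ D.modularDegree :=
  (pow_dvd_pow 2 (by omega)).trans (h172 W D hN hIV hT)

/-! ### §3. Edges (proved) -/

/-- `2^k ∣ d` with `2 ≤ k` gives `4 ∣ d`. -/
theorem four_dvd_of_two_pow_dvd {k d : ℕ} (hk : 2 ≤ k) (h : 2 ^ k ∣ d) : 4 ∣ d :=
  (show (4 : ℕ) = 2 ^ 2 by norm_num) ▸ (pow_dvd_pow 2 hk).trans h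

/-- On the tame cell with an odd prime factor, `ω(N) ≥ 2`. -/
theorem two_le_card_primeFactors {N p : ℕ} (h2 : 2 ∣ N) (hp : p.Prime) (hp2 : p ≠ 2) (hpN : p ∣ N) (hN : N ≠ 0) :
    2 ≤ N.primeFactors.card := by
  have h2m : 2 ∈ N.primeFactors := Nat.mem_primeFactors.mpr ⟨Nat.prime_two, h2, hN⟩
  have hpm : p ∈ N.primeFactors := Nat.mem_primeFactors.mpr ⟨hp, hpN, hN⟩
  calc 2 = ({2, p} : Finset ℕ).card := (Finset.card_pair (Ne.symm hp2)).symm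
    _ ≤ N.primeFactors.card := Finset.card_le_card (by
        intro x hx
        rcases Finset.mem_insert.mp hx with rfl | hx
        · exact h2m
        · rw [Finset.mem_singleton.mp hx]; exact hpm)

/-- E-es-171♯ ⟹ the weak form E-es-171 «`4 ∣ deg φ`» as soon as `N` has an odd prime factor. -/
theorem four_dvd_modularDegree_of_fourStar_fricke_plus (h171 : FourStarFrickePlusSharp)
    (W : WeierstrassCurve ℚ) [W.IsElliptic] [W.IsGloballyMinimal] {N : ℕ} [NeZero N]
    (D : ModularParametrizationData W N) (hN : W.conductorNorm ℤ = N)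
    (hIV : IsTypeFourStarAtTwoTame W) (hT : ¬ HasRationalTwoTorsion W) (hF : frickeInvolution N 2 D.f = D.f)
    {p : ℕ} (hp : p.Prime) (hp2 : p ≠ 2) (hpN : p ∣ N) : 4 ∣ D.modularDegree := by
  have h2 : 2 ∣ N := by
    have hv : padicValNat 2 N = 2 := hN ▸ hIV.1
    by_contra h
    rw [padicValNat.eq_zero_of_not_dvd h] at hv
    exact absurd hv (by norm_num)
  exact four_dvd_of_two_pow_dvd (two_le_card_primeFactors h2 hp hp2 hpN (NeZero.ne N)) (h171 W D hN hIV hT hF)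

-- TYPER (T-es-68 split): `four_dvd_modularDegree_fourP_of_atkinLehner_p_eq_neg` (N = 4p, w_p f = −f ⟹ 4 ∣ deg φ, mod E-es-171♯)
-- is PROVED in the cone sibling `AtkinLehnerDegreeLawsSplit.lean` (it needs `frickeInvolution_eq_self_of_atkinLehnerInvolutionAt_p_eq_neg`).

/-- E-es-168♯ ⟹ E-es-168 (weak form, at conductor level with an odd prime factor). -/
theorem four_dvd_modularDegree_of_fourStar_localTwoTorsion_sharp (h168 : FourStarLocalTwoTorsionSharp)
    (W : WeierstrassCurve ℚ) [W.IsElliptic] [W.IsGloballyMinimal] {N : ℕ} [NeZero N]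
    (D : ModularParametrizationData W N) (hN : W.conductorNorm ℤ = N)
    (hIV : IsTypeFourStarAtTwoTame W) (hloc : ¬ NoLocalTwoTorsionAtTwo W) (hT : ¬ HasRationalTwoTorsion W)
    {p : ℕ} (hp : p.Prime) (hp2 : p ≠ 2) (hpN : p ∣ N) : 4 ∣ D.modularDegree := by
  have h2 : 2 ∣ N := by
    have hv : padicValNat 2 N = 2 := hN ▸ hIV.1
    by_contra h
    rw [padicValNat.eq_zero_of_not_dvd h] at hv
    exact absurd hv (by norm_num)
  exact four_dvd_of_two_pow_dvd (two_le_card_primeFactors h2 hp hp2 hpN (NeZero.ne N)) (h168 W D hN hIV hloc hT)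

/-- The union of the three sharp laws: on the tame cell without rational 2-torsion, `2^{ω(N)} ∣ deg φ` whenever
(IV* ∧ local 2-torsion) ∨ Gaussian level ∨ (IV* ∧ Fricke sign `+1`) — 63 428 / 63 428 IV* curves + the Gaussian IV
curves; the complement (IV* depth 3 non-Gaussian Fricke `−1`, and non-Gaussian IV) is where `deg φ♭` is observed odd. -/
theorem two_pow_card_primeFactors_dvd_modularDegree_of_laws (hAL : GaussianLevelSharp)
    (h168 : FourStarLocalTwoTorsionSharp) (h171 : FourStarFrickePlusSharp)
    (W : WeierstrassCurve ℚ) [W.IsElliptic] [W.IsGloballyMinimal] {N : ℕ} [NeZero N]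
    (D : ModularParametrizationData W N) (hN : W.conductorNorm ℤ = N) (hT : ¬ HasRationalTwoTorsion W)
    (h : (IsTypeFourStarAtTwoTame W ∧ ¬ NoLocalTwoTorsionAtTwo W) ∨
      (padicValNat 2 N = 2 ∧ AllOddPrimeFactorsOneModFour N) ∨
      (IsTypeFourStarAtTwoTame W ∧ frickeInvolution N 2 D.f = D.f)) :
    2 ^ N.primeFactors.card ∣ D.modularDegree := by
  rcases h with ⟨hIV, hloc⟩ | ⟨h2, hG⟩ | ⟨hIV, hF⟩
  · exact h168 W D hN hIV hloc hT
  · exact hAL W D hN h2 hG hT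
  · exact h171 W D hN hIV hT hF

end Summit.BirchSwinnertonDyer.Rank1Residual.ManinAdditive.AtkinLehnerDegree
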